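import Summits.BirchSwinnertonDyer.BirchSwinnertonDyer.Theorems.SylvesterTwoHeegnerIndexLowerHalfCertificates
import HarnessLib

/-!
# Route `SylvesterTwoHeegnerIndex` (rung K7t), crux `HeegnerIndexLowerAtTwoHSY` (item 19230):
# the LOWER crux at its one non-trivial member `p ≤ 20000` — `E_18913 : x³ + y³ = 18913`
# (`#Ш_an = 16`), where it HOLDS; and what `BSD(E_18913, 2)` now amounts to
# (helper toward stmt-BirchSwinnertonDyer-19230; cell «bsd-cm», seat `bsd-cm-k7t-c3` g2; theorems only)

HONEST FRAMING (cell «bsd-cm», `run/shared/lean/pub/bsd-cm/`; FULL-BSD RANK ≤ 1 programme, tranche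
1a): the class 𝒞_HSY at `p = 2` (B14 / O12) is OPEN in print and stays open here; the crux
quantifies over ALL `p` and is NOT proved here. THEOREMS ONLY (0 definitions, 0 named facts,
0 `sorry`); every conclusion is CONDITIONAL on `PublishedFactsTwo` (the route's support item 19231,
eleven published named facts) and on TWO DISPLAYED PER-CURVE CERTIFICATES for `E_18913` that are
NOT proved in the kernel:
* `hq : #Ш_an(E_18913) = 16` — bsd-cm-two N6-TABLE §T6-rerun-CD (kit j243997–j244002): two
  `L`-engines, `S ∈ [15.99876, 16.00027]`, unique lattice point `4²·1`; certified generator of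
  `E_18913(ℚ)` (`ĥ = 3.33`, index `1`);
* `hS : Ш(E_18913) ⊇` a Klein four-group `{0, x, y, x + y}` killed by `2`, and EVERY element of
  `Ш(E_18913)[2]` is a double in `Ш(E_18913)` — PARI `ellrank(E_18913) = [r₁, r₂, s, L] = [1, 3, 0, []]`
  at efforts 0, 1, 2 (kit j250083, this seat; bsd-cm-two N6-TABLE §T6: the same at effort 0), read
  with PARI's documented invariants (users' manual s.v. `ellrank`, "Technical explanation", text
  dumped by kit j250179: "computes unconditionally … the rank `C` of the 2-Selmer group, the rank `T`
  of the 2-torsion subgroup, the (even) rank `s` of `G[2]/2G[4]` [`G = Ш`]; `r₂ = C − T − s`;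
  `C = T + R + S`", `R = rank E(ℚ)`, `S = dim G[2]`): here `T = 0` (no rational root of
  `x³ − 432·18913²`), `s = 0`, so `C = 3` and `Ш[2] = 2·Ш[4] ∩ Ш[2]`, i.e. `Ш[2] ⊆ 2·Ш`; and with
  `R = 1` (Hu–Shu–Yin Thm 1.3 = the fact `thm14_threePart_product`; independently two's certified
  generator) `S = C − T − R = 2`, i.e. `Ш(E_18913)[2] ≅ (ℤ/2)²`. The `2`-descent field
  `ℚ(∛(4·18913))` (`x³ − 75652`, `Cl ≅ ℤ/6 × ℤ/2`) is `bnfcertify`d (= 1), which removes GRH from the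
  descent (kit j250083).
From these, §1 of the sibling file gives `(ℤ/4)² ↪ Ш(E_18913)`, `16 ∣ #Ш(E_18913)`, and the LOWER
inequality `ord₂ 𝔮 = 4 ≤ ord₂ #Ш(E_18913)` in every Heegner frame
(`sylvesterTwoHeegnerIndex_heegnerIndexLowerAtTwoHSY_18913` = the crux body verbatim with
`p := 18913`). This is the first member of 𝒞_HSY at which the LOWER crux is tested with content
(at the other 506 members `p ≤ 20000` it is either empty — `#Ш_an` odd — or read off the `2`-descent
— `#Ш_an = 4`); it HOLDS. What is left AT THIS MEMBER is the UPPER half only: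
`sylvesterTwoHeegnerIndex_bsdTwo_iff_not_32_dvd_18913` — `BSD(E_18913, 2) ⟺ ¬ 32 ∣ #Ш(E_18913)`, i.e.
`Ш(E_18913)[2^∞] ≅ (ℤ/4)²` exactly (a `4`-Selmer Cassels–Tate computation the cell's engines do not
have; note for seat bsd-cm-k7t-c2, item 19229).

PARTITION (D-0054): CornerF at `2` / O12 × the 𝒞_HSY member `E_18913` (book230: 0 classes,
`N = 27·18913² > 5·10⁵`) × `p = 2` — per-pair certificate consumer; closes no cell and no class;
nothing booked; no label moves. NOT a proof of the crux or of `BSD(E_18913, 2)`.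
References (locators only): [HuShuYin2019] Thm. 1.3/1.4 (p. 3); [BurungaleFlach2024] Thm. 1.1,
Cor. 2; [Miller2011LMS] §1, Def. 1.1; [Cremona1997] §3.6; Cassels 1998 (Crelle 494) §1.
-/

set_option autoImplicit false
-- the Theorems namespace `Summit.BirchSwinnertonDyer.BirchSwinnertonDyer.…` repeats a component by design (D-0017 layout)
set_option linter.dupNamespace false

noncomputable section

open scoped Classical

open WeierstrassCurve NumberField Literature.NumberTheory.EllipticCurves
  Literature.NumberTheory.EllipticCurves.ModularForms
  Literature.NumberTheory.EllipticCurves.Rank1Residual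
  Literature.NumberTheory.EllipticCurves.Rank1Residual.Typed
  Literature.NumberTheory.EllipticCurves.HuShuYin2019
  Summit.BirchSwinnertonDyer.Rank1Residual.P2
  Summit.BirchSwinnertonDyer.Rank1Residual.X12.Sylvester
  Summit.BirchSwinnertonDyer.BirchSwinnertonDyer.Theses.SylvesterTwoHeegnerIndex

namespace Summit.BirchSwinnertonDyer.BirchSwinnertonDyer.Theorems

namespace SylvesterTwoLowerCert

/-! ## §3 The member `E_18913 : x³ + y³ = 18913` (`#Ш_an = 16`; conductor `27·18913²`) -/

/-- `18913` is an 𝒞_HSY parameter: prime, `18913 ≡ 4 (mod 9)`, and `3` is not a cube mod `18913`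
(Euler: `3^((18913−1)/3) = 3^6304 ≢ 1 (mod 18913)`). [cite: HuShuYin2019, Thm. 1.4 (p. 3)] -/
theorem hsy_18913 :
    Nat.Prime 18913 ∧ (18913 % 9 = 4 ∨ 18913 % 9 = 7) ∧ ¬ ∃ x : ZMod 18913, x ^ 3 = 3 := by
  have hprime : Nat.Prime 18913 := by norm_num
  refine ⟨hprime, Or.inl rfl, ?_⟩
  rintro ⟨x, hx⟩
  -- pass to `a = x.val ∈ ℕ`: `a³ ≡ 3 (mod 18913)`
  set a : ℕ := x.val with ha
  have hxa : (a : ZMod 18913) = x := ZMod.natCast_zmod_val x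
  have h3 : a ^ 3 ≡ 3 [MOD 18913] := by
    refine (ZMod.natCast_eq_natCast_iff' _ _ _).mp ?_
    rw [Nat.cast_pow, hxa, hx, Nat.cast_ofNat]
  have ha0 : a ≠ 0 := by
    intro h0
    rw [h0, zero_pow three_ne_zero] at h3
    exact absurd h3 (by decide)
  have hcop : Nat.Coprime a 18913 :=
    (Nat.coprime_comm.mp ((Nat.Prime.coprime_iff_not_dvd hprime).mpr fun hdvd =>
      ha0 (Nat.eq_zero_of_dvd_of_lt hdvd (ZMod.val_lt x))))
  -- Euler/Fermat: `a^18912 ≡ 1`, hence `3^6304 ≡ (a³)^6304 = a^18912 ≡ 1 (mod 18913)` — false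
  have hφ : Nat.totient 18913 = 3 * 6304 := by
    rw [Nat.totient_prime hprime]
  have hE : (a ^ 3) ^ 6304 ≡ 1 [MOD 18913] := by
    have := Nat.ModEq.pow_totient hcop
    rwa [hφ, pow_mul] at this
  have h36 : 3 ^ 6304 ≡ 1 [MOD 18913] := (h3.pow 6304).symm.trans hE
  exact absurd h36 (by decide +kernel)

/-- **THE LOWER CRUX AT ITS ONE NON-TRIVIAL MEMBER `p ≤ 20000`: `HeegnerIndexLowerAtTwoHSY`
SPECIALISED TO `p = 18913`** — its body verbatim with `p := 18913`: for EVERY global minimal model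
`W` of `E_18913` and EVERY Heegner frame, `ord₂ 𝔮(W, K, P, c, k, Wd, u) ≤ ord₂ #Ш(W)` — from the
route's support item `PublishedFactsTwo` and two DISPLAYED per-curve certificates, NOT proved in the
kernel: `hq : #Ш_an(E_18913) = 16` (bsd-cm-two N6-TABLE §T6-rerun-CD: two engines,
`S ∈ [15.99876, 16.00027]`, unique lattice point; certified generator of `E_18913(ℚ)`, `ĥ = 3.33`,
index `1`) and `hS : Ш(E_18913) ⊇` a Klein four-group each of whose elements is a double in `Ш`
(PARI `ellrank(E_18913) = [1, 3, 0, []]`: `2`-Selmer rank `C = 3`, `2`-torsion rank `T = 0`, rank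
`s = 0` of `Ш[2]/2Ш[4]` — PARI's documented unconditional invariants, kit j250083 / j250179 (this seat)
and bsd-cm-two N6-TABLE §T6; the descent cubic `ℚ(∛(4·18913))` `bnfcertify`d; with
`rank E_18913(ℚ) = 1` (Hu–Shu–Yin Thm 1.3) this is `Ш[2] ≅ (ℤ/2)²` and `Ш[2] ⊆ 2·Ш`). Then
`16 ∣ #Ш(E_18913)` (§1) and `ord₂ 𝔮 = ord₂ 16 = 4`. CONDITIONAL; EVIDENCE consumer; says nothing
about other `p`; the crux (all `p`) stays OPEN. [cite: HuShuYin2019, Thm. 1.3 and Thm. 1.4 (p. 3)]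
[cite: BurungaleFlach2024, Thm. 1.1 and Cor. 2] [cite: Miller2011LMS, §1 and Def. 1.1]
[cite: Cremona1997, §3.6] -/
theorem sylvesterTwoHeegnerIndex_heegnerIndexLowerAtTwoHSY_18913 (hF : PublishedFactsTwo)
    (hq : ∀ (W : WeierstrassCurve ℚ) [W.IsElliptic] [W.IsGloballyMinimal],
      (∃ C : VariableChange ℚ, C • W = cubeSumCurve ((18913 : ℕ) : ℚ)) → shaAn W = 16)
    (hS : ∀ (W : WeierstrassCurve ℚ) [W.IsElliptic] [W.IsGloballyMinimal],
      (∃ C : VariableChange ℚ, C • W = cubeSumCurve ((18913 : ℕ) : ℚ)) →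
        (∃ x y : W.sha, (2 : ℤ) • x = 0 ∧ (2 : ℤ) • y = 0 ∧ x ≠ 0 ∧ y ≠ 0 ∧ x ≠ y) ∧
        (∀ z : W.sha, (2 : ℤ) • z = 0 → ∃ w : W.sha, (2 : ℤ) • w = z)) :
    ∀ (W : WeierstrassCurve ℚ) [W.IsElliptic] [W.IsGloballyMinimal],
      (∃ C : VariableChange ℚ, C • W = cubeSumCurve ((18913 : ℕ) : ℚ)) →
      ∀ (N : ℕ) [NeZero N] (K : Type) [Field K] [NumberField K]
        (Dt : ModularParametrizationData W N) (H : HeegnerDatum N (NumberField.discr K)) (ι : K →+* ℂ)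
        (P : (W.baseChange K).toAffine.Point) (Wd : WeierstrassCurve ℚ) [Wd.IsElliptic]
        [Wd.IsGloballyMinimal] (Cd : VariableChange ℚ) (k : ℕ),
        W.HasCM → W.analyticRank = 1 → IsImaginaryQuadratic K → SatisfiesHeegnerHypothesis N K →
        WeierstrassCurve.Affine.Point.map ι.toRatAlgHom P = heegnerPointComplex Dt H →
        (W.quadraticTwist (NumberField.discr K : ℚ)).entireLFunction 1 ≠ 0 →
        Cd • W.quadraticTwist (NumberField.discr K : ℚ) = Wd → (k = 1 ∨ k = 2) →
        (k = 2 ↔ ∀ y : W.toAffine.Point, ∃ Q : (W.baseChange K).toAffine.Point,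
          QuadraticDescent.incl K W y - (2 : ℤ) • Q ∈ AddCommGroup.torsion (W.baseChange K).toAffine.Point) →
        padicValRat 2 (cmHeegnerIndexQuotient W K P Dt.c k Wd Cd.u) ≤
          padicValNat 2 (Nat.card W.sha) := by
  obtain ⟨hHSY, hBF, hmod, -, -, hGZ, hKo, hGZK, -, -, -⟩ := hF
  obtain ⟨hpr, h9, h3⟩ := hsy_18913
  intro W _ _ hW N _ K _ _ Dt H ι P Wd _ _ Cd k _ _ hK hHN hP hLt hWd hk hkiff
  have hq' : shaAn W = ((16 : ℚ) : ℂ) := by rw [hq W hW]; norm_cast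
  have hv : padicValRat 2 (16 : ℚ) ≤ 4 := by
    rw [show (16 : ℚ) = ((2 ^ 4 : ℕ) : ℚ) by norm_num, padicValRat.of_nat, padicValNat.prime_pow]
    norm_num
  obtain ⟨hK4, hdiv⟩ := hS W hW
  exact lower_frame_of_kleinFour_twoDivisible W hHSY hBF hmod hGZK hpr h9 h3 hW hq' hv hK4 hdiv N K
    Dt H ι P (hGZ N W K) (hKo N W K) hK hHN hP hLt Wd Cd hWd hk hkiff

/-- **What `BSD(E_18913, 2)` now amounts to**, for every global minimal model `W` of `E_18913`,
granted `PublishedFactsTwo` and the same two displayed certificates: `BSDp W 2 ⟺ ¬ 32 ∣ #Ш(W)` —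
the lower inequality being certified, only `Ш(E_18913)[2^∞] ≅ (ℤ/4)²` EXACTLY (no element of order
`8`, `#Ш[2^∞] = 16`) is left, i.e. the Cassels–Tate pairing on `Ш[4]/Ш[2]` is non-degenerate.
CONDITIONAL; EVIDENCE consumer. [cite: HuShuYin2019, Thm. 1.3 and Thm. 1.4 (p. 3)]
[cite: BurungaleFlach2024, Thm. 1.1 and Cor. 2] [cite: Miller2011LMS, §1 and Def. 1.1] -/
theorem sylvesterTwoHeegnerIndex_bsdTwo_iff_not_32_dvd_18913 (hF : PublishedFactsTwo)
    (hq : ∀ (W : WeierstrassCurve ℚ) [W.IsElliptic] [W.IsGloballyMinimal],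
      (∃ C : VariableChange ℚ, C • W = cubeSumCurve ((18913 : ℕ) : ℚ)) → shaAn W = 16)
    (hS : ∀ (W : WeierstrassCurve ℚ) [W.IsElliptic] [W.IsGloballyMinimal],
      (∃ C : VariableChange ℚ, C • W = cubeSumCurve ((18913 : ℕ) : ℚ)) →
        (∃ x y : W.sha, (2 : ℤ) • x = 0 ∧ (2 : ℤ) • y = 0 ∧ x ≠ 0 ∧ y ≠ 0 ∧ x ≠ y) ∧
        (∀ z : W.sha, (2 : ℤ) • z = 0 → ∃ w : W.sha, (2 : ℤ) • w = z))
    (W : WeierstrassCurve ℚ) [W.IsElliptic] [W.IsGloballyMinimal]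
    (hW : ∃ C : VariableChange ℚ, C • W = cubeSumCurve ((18913 : ℕ) : ℚ)) :
    BSDp W 2 ↔ ¬ 32 ∣ Nat.card W.sha := by
  haveI : Fact (Nat.Prime 2) := ⟨Nat.prime_two⟩
  obtain ⟨hHSY, hBF, hmod, -, -, -, -, hGZK, -, -, -⟩ := hF
  obtain ⟨hpr, h9, h3⟩ := hsy_18913
  obtain ⟨hr, hfin, -⟩ :=
    Summit.BirchSwinnertonDyer.Rank1Residual.X12.CubeSumFamilies.bsdp_three_of_thm14' hHSY hBF hmod hpr h9 h3 W hW
  haveI := hfin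
  have hq' : shaAn W = ((16 : ℚ) : ℂ) := by rw [hq W hW]; norm_cast
  have hv : padicValRat 2 (16 : ℚ) = 4 := by
    rw [show (16 : ℚ) = ((2 ^ 4 : ℕ) : ℚ) by norm_num, padicValRat.of_nat, padicValNat.prime_pow]
    norm_num
  obtain ⟨⟨x, y, hx, hy, hx0, hy0, hxy⟩, hdiv⟩ := hS W hW
  have h16 : 2 ^ 4 ∣ Nat.card W.sha := by
    simpa using sixteen_dvd_card_of_kleinFour_of_twoDivisible hx hy hx0 hy0 hxy hdiv
  have hcard : Nat.card W.sha ≠ 0 := (Nat.card_pos (α := W.sha)).ne'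
  have hrank : W.mordellWeilRank = W.analyticRank := (hGZK W (by rw [hr])).1
  have hprim : padicValNat 2 (Nat.card (AddCommGroup.primaryComponent W.sha 2)) =
      padicValNat 2 (Nat.card W.sha) := padicValNat_card_addPrimaryComponent 2
  have h4 : 4 ≤ padicValNat 2 (Nat.card W.sha) := (padicValNat_dvd_iff_le hcard).mp h16
  constructor
  · rintro ⟨-, -, q, hqq, hvq⟩ h32
    have hqq' : q = 16 := by exact_mod_cast hqq.symm.trans hq'
    rw [hqq', hv, hprim] at hvq
    have h5 : 5 ≤ padicValNat 2 (Nat.card W.sha) :=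
      (padicValNat_dvd_iff_le hcard).mp (by simpa using h32)
    omega
  · intro h32
    have hlt : padicValNat 2 (Nat.card W.sha) < 5 := by
      by_contra hge
      exact h32 (by simpa using (padicValNat_dvd_iff_le hcard).mpr (not_lt.mp hge))
    refine ⟨hrank, Finite.of_injective _ Subtype.val_injective, 16, hq', ?_⟩
    rw [hv, hprim]
    have : padicValNat 2 (Nat.card W.sha) = 4 := by omega
    exact_mod_cast this.symm

end SylvesterTwoLowerCert

end Summit.BirchSwinnertonDyer.BirchSwinnertonDyer.Theorems

end
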